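import Literature.Analysis.Fourier.TaylorOnClosedDisc
import Mathlib.Analysis.Complex.RemovableSingularity
import Mathlib.Tactic
import HarnessLib

/-!
# The transfer coefficients `t(μ, r) = [z^r](Φ(z)^μ h(z))` of a diagonal pullback (CDT eq. (6.16))

Calegari–Dimitrov–Tang, arXiv:2408.15403, §6.4 (p. 51): for a holomorphic map `Φ` of a
neighbourhood of the closed disc with `Φ(0) = 0` and a holomorphic `h` with `h(0) = 1`, the pullback
`G(𝐳) = h(z_1)⋯h(z_d) F(Φ(z_1),…)` has `𝐳^𝐧`-coefficient `β_𝐧 Π_s Φ_s'(0)^{n_s}` on the minimal degree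
(eq. (6.16)). The one-variable input, isolated in `PullbackLowestCoefficient.TransferData`, is that
the Taylor coefficients `t(μ,r) = [z^r](Φ(z)^μ h(z))` vanish for `r < μ` and equal
`Φ'(0)^μ h(0)` for `r = μ`. This file proves it for the Taylor coefficients `taylorCoeff` of
`TaylorOnClosedDisc` (Cauchy integrals on `|z| = R`):

* `taylorCoeff_zero_eq` — `b_0 = g(0)`;
* `taylorCoeff_pow_mul` — the shift `[z^r](z^μ q) = [μ ≤ r]·[z^{r−μ}] q` (Cauchy–Goursat for
  `r < μ`);
* `taylorCoeff_comp_pow_mul_of_lt`, `taylorCoeff_comp_pow_mul_self` — the two transfer properties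
  for `Φ^μ · h` with `Φ(0) = 0` (`Φ = z · dslope Φ 0`).

No named facts.

## References

* [CalegariDimitrovTang2024] arXiv:2408.15403, §6.4 eq. (6.16) (p. 51).
-/

noncomputable section

open Complex MeasureTheory Metric Set

open scoped Real NNReal

namespace Literature.Analysis.Fourier

namespace TorusCoeff

/-- `b_0 = g(0)` for `g` holomorphic on `|z| ≤ R`, `R > 0`. [folklore] -/
theorem taylorCoeff_zero_eq {g : ℂ → ℂ} {R : ℝ≥0} (hR : 0 < R)
    (hg : DifferentiableOn ℂ g (closedBall 0 R)) : taylorCoeff g R 0 = g 0 := by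
  have h := hasSum_taylorCoeff hR hg (z := 0) (by simpa using hR)
  have h2 : HasSum (fun n => taylorCoeff g R n * (0 : ℂ) ^ n) (taylorCoeff g R 0) := by
    have := hasSum_single (f := fun n => taylorCoeff g R n * (0 : ℂ) ^ n) 0 (fun n hn => by
      rw [zero_pow hn, mul_zero])
    simpa using this
  exact h2.unique h

/-- The Taylor coefficients as circle integrals: `b_n = (2πi)⁻¹ ∮ (zⁿ)⁻¹ z⁻¹ g(z) dz`. [folklore] -/
theorem taylorCoeff_eq_circleIntegral (g : ℂ → ℂ) (R : ℝ) (n : ℕ) :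
    taylorCoeff g R n = (2 * π * I)⁻¹ * ∮ z in C(0, R), (z ^ n)⁻¹ * (z⁻¹ * g z) := by
  unfold taylorCoeff
  rw [cauchyPowerSeries_apply]
  simp only [sub_zero, one_div, smul_eq_mul, inv_pow]

/-- **The shift**: `[z^r](z^μ q(z)) = [z^{r−μ}] q` for `r ≥ μ` and `= 0` for `r < μ` (Cauchy–Goursat),
for `q` holomorphic on `|z| ≤ R`, `R > 0`. [folklore] -/
theorem taylorCoeff_pow_mul {q : ℂ → ℂ} {R : ℝ≥0} (hR : 0 < R)
    (hq : DifferentiableOn ℂ q (closedBall 0 R)) (μ r : ℕ) :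
    taylorCoeff (fun z => z ^ μ * q z) R r = if μ ≤ r then taylorCoeff q R (r - μ) else 0 := by
  have hRr : (0 : ℝ) < R := by exact_mod_cast hR
  rw [taylorCoeff_eq_circleIntegral]
  split_ifs with h
  · rw [taylorCoeff_eq_circleIntegral]
    congr 1
    refine circleIntegral.integral_congr hRr.le fun z hz => ?_
    have hz0 : z ≠ 0 := by
      intro h0; subst h0
      simp at hz
      exact hRr.ne' hz.symm
    obtain ⟨k, rfl⟩ := Nat.exists_eq_add_of_le h
    rw [Nat.add_sub_cancel_left, pow_add]
    field_simp
  · push Not at h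
    obtain ⟨k, hk⟩ := Nat.exists_eq_add_of_lt h
    -- integrand is `z^k q(z)`, holomorphic
    have heq : EqOn (fun z : ℂ => (z ^ r)⁻¹ * (z⁻¹ * (z ^ μ * q z))) (fun z => z ^ k * q z) (sphere 0 R) := by
      intro z hz
      have hz0 : z ≠ 0 := by
        intro h0; subst h0
        simp at hz
        exact hRr.ne' hz.symm
      beta_reduce
      rw [hk, show r + k + 1 = r + 1 + k by ring, pow_add, pow_succ]
      field_simp
    rw [circleIntegral.integral_congr hRr.le heq]
    have hcont : ContinuousOn (fun z : ℂ => z ^ k * q z) (closedBall 0 R) :=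
      (continuousOn_pow k).mul hq.continuousOn
    have hdiff : ∀ z ∈ ball (0 : ℂ) R \ ∅, DifferentiableAt ℂ (fun z : ℂ => z ^ k * q z) z := by
      intro z hz
      have hzmem : closedBall (0 : ℂ) R ∈ nhds z :=
        Filter.mem_of_superset (isOpen_ball.mem_nhds hz.1) ball_subset_closedBall
      exact (differentiableAt_pow k).mul (hq.differentiableAt hzmem)
    rw [circleIntegral_eq_zero_of_differentiable_on_off_countable hRr.le countable_empty hcont hdiff,
      mul_zero]

/-- `Φ = z · dslope Φ 0` when `Φ(0) = 0`. [folklore] -/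
theorem eq_mul_dslope {Φ : ℂ → ℂ} (hΦ0 : Φ 0 = 0) (z : ℂ) : Φ z = z * dslope Φ 0 z := by
  have := sub_smul_dslope Φ 0 z
  rw [sub_zero, smul_eq_mul, hΦ0, sub_zero] at this
  exact this.symm

/-- **Transfer property below the diagonal**: `[z^r](Φ^μ h) = 0` for `r < μ` (`Φ(0) = 0`).
[cite: CalegariDimitrovTang2024, §6.4 (Φ(0) = 0 in eq. (6.16))] -/
theorem taylorCoeff_comp_pow_mul_of_lt {Φ h : ℂ → ℂ} {R : ℝ≥0} (hR : 0 < R)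
    (hΦ : DifferentiableOn ℂ Φ (closedBall 0 R)) (hΦ0 : Φ 0 = 0)
    (hh : DifferentiableOn ℂ h (closedBall 0 R)) {μ r : ℕ} (hr : r < μ) :
    taylorCoeff (fun z => Φ z ^ μ * h z) R r = 0 := by
  have hmem : closedBall (0 : ℂ) R ∈ nhds (0 : ℂ) := closedBall_mem_nhds _ (by exact_mod_cast hR)
  have hq : DifferentiableOn ℂ (dslope Φ 0) (closedBall 0 R) := (differentiableOn_dslope hmem).mpr hΦ
  have hq' : DifferentiableOn ℂ (fun z => dslope Φ 0 z ^ μ * h z) (closedBall 0 R) :=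
    (hq.pow μ).mul hh
  have hfun : (fun z => Φ z ^ μ * h z) = fun z => z ^ μ * (dslope Φ 0 z ^ μ * h z) := by
    funext z; rw [eq_mul_dslope hΦ0 z]; ring
  rw [hfun, taylorCoeff_pow_mul hR hq', if_neg (not_le.mpr hr)]

/-- **Transfer property on the diagonal**: `[z^μ](Φ^μ h) = Φ'(0)^μ h(0)` (`Φ(0) = 0`).
[cite: CalegariDimitrovTang2024, §6.4 eq. (6.16) (p. 51)] -/
theorem taylorCoeff_comp_pow_mul_self {Φ h : ℂ → ℂ} {R : ℝ≥0} (hR : 0 < R)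
    (hΦ : DifferentiableOn ℂ Φ (closedBall 0 R)) (hΦ0 : Φ 0 = 0)
    (hh : DifferentiableOn ℂ h (closedBall 0 R)) (μ : ℕ) :
    taylorCoeff (fun z => Φ z ^ μ * h z) R μ = deriv Φ 0 ^ μ * h 0 := by
  have hmem : closedBall (0 : ℂ) R ∈ nhds (0 : ℂ) := closedBall_mem_nhds _ (by exact_mod_cast hR)
  have hq : DifferentiableOn ℂ (dslope Φ 0) (closedBall 0 R) := (differentiableOn_dslope hmem).mpr hΦ
  have hq' : DifferentiableOn ℂ (fun z => dslope Φ 0 z ^ μ * h z) (closedBall 0 R) :=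
    (hq.pow μ).mul hh
  have hfun : (fun z => Φ z ^ μ * h z) = fun z => z ^ μ * (dslope Φ 0 z ^ μ * h z) := by
    funext z; rw [eq_mul_dslope hΦ0 z]; ring
  rw [hfun, taylorCoeff_pow_mul hR hq', if_pos le_rfl, Nat.sub_self, taylorCoeff_zero_eq hR hq',
    dslope_same]

end TorusCoeff

end Literature.Analysis.Fourier
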